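import Summits.BirchSwinnertonDyer.BirchSwinnertonDyer.Theorems.TwoAdicConverseTwoDivisionCubicDyadicType
import Summits.BirchSwinnertonDyer.BirchSwinnertonDyer.Theorems.AlignedTransportAtTwoMainConjectureTransportAlignedAtTwoBridge
import HarnessLib

/-!
# Route `TwoAdicConverse` (rung S3), crux `OrdLambdaHalfAtTwo` (item 19556), reserve `elliptic-shadow-two` / line
# `f4-semisimple-cubic-two`: the CUBIC `2`-DIVISION FIELD exists (the sketch's `hfield`), and the `u`-cubic
# `twoDivisionUCubic W = X³ + b₂X² + 8b₄X + 16b₆` has a `2`-adic UNIT root at an ordinary `2`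

Cell `bsd-2adic`, seat `bsd-2adic-conv-1` (GEN 21). THEOREMS ONLY — no named fact, no definition, nothing conditional. Two
vocabulary bridges for the 19556 lines on the irreducible-`E[2]` strata, in the currency `twoDivisionUCubic` of
`Rank1Residual/F1Sign2/AnalyticLineTransferAtTwo` (the shadow reserve's and the KRR2/AlignedTransport routes' cubic):

* `exists_cubicNumberField_aeval_twoDivisionUCubic_eq_zero` — for `E(ℚ)[2] = 0` the `u`-cubic is irreducible (tree
  `AlignedTransportAtTwoBridge.irreducible_twoDivisionUCubic`, reused by name: the gate's dedup rule prefers the import over a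
  route-independent copy), so `K = ℚ[X]/(u-cubic)` is a NUMBER FIELD of degree `3` containing a root: this
  DISCHARGES verbatim the hypothesis `hfield` of `Cruxes/OrdLambdaHalfAtTwo/EllipticShadowTwoSketch.lean`
  (`ordLambdaHalfAtTwo_of_shadow`), for every `W` with no rational `2`-torsion (in particular on the rigid locus `𝔖⁻`).
* `exists_padicInt_aeval_twoDivisionUCubic_eq_zero_of_odd_a₁` — for `a₁` odd (good ordinary or multiplicative at `2`) the
  `u`-cubic has a root `u₀ ∈ ℤ₂` with `‖u₀‖ = 1` (the Hensel root of `TwoAdicConverseTwoDivisionCubicSplitsAtTwo`, §1, read in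
  this currency; `u₀/4` is the ψ₂²-root of valuation `−2`).

HONEST FRAMING: algebra only; nothing about `λ`, Selmer groups or BSD; items 19556 / 19218 stay OPEN; BSD is not proved by any
of this. PARTITION (D-0054): none — RANK axis (S3). References: J. H. Silverman, *AEC* (2009), III.2.3 (`ψ₂`); Mathlib
`AdjoinRoot`, `hensels_lemma`. [SilvermanAEC2009]
-/

set_option linter.dupNamespace false
set_option autoImplicit false

noncomputable section

open scoped Classical
open Polynomial WeierstrassCurve Literature.NumberTheory.EllipticCurves Literature.NumberTheory.EllipticCurves.Greenberg1999
  Literature.NumberTheory.EllipticCurves.Rank1Residual Summit.BirchSwinnertonDyer.Rank1Residual.F1Sign2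


namespace Summit.BirchSwinnertonDyer.BirchSwinnertonDyer.Theorems.TwoAdicTwistConverse

variable (W : WeierstrassCurve ℚ) [W.IsElliptic] [W.IsGloballyMinimal]

omit [W.IsElliptic] [W.IsGloballyMinimal] in
/-- **The cubic `2`-division field exists (discharge of the shadow sketch's `hfield`).** If `E(ℚ)[2] = 0`
(`∀ x, ¬ HasRationalTwoTorsionX W x`) then there is a number field `K` with `[K : ℚ] = 3` and an element `e ∈ K` with
`u-cubic(e) = 0` — namely `K = ℚ[X]/(X³ + b₂X² + 8b₄X + 16b₆)`, a field because the `u`-cubic is irreducible.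
[cite: SilvermanAEC2009, III.2.3] -/
theorem exists_cubicNumberField_aeval_twoDivisionUCubic_eq_zero (ht : ∀ x : ℚ, ¬ HasRationalTwoTorsionX W x) :
    ∃ (K : Type) (_ : Field K) (_ : NumberField K), Module.finrank ℚ K = 3 ∧
      ∃ e : K, aeval e (twoDivisionUCubic W) = 0 := by
  haveI : Fact (Irreducible (twoDivisionUCubic W)) := ⟨AlignedTransportAtTwoBridge.irreducible_twoDivisionUCubic W ht⟩
  have hdeg : (twoDivisionUCubic W).natDegree = 3 := by unfold twoDivisionUCubic; compute_degree!
  have h0 : twoDivisionUCubic W ≠ 0 := fun h ↦ by simp [h] at hdeg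
  refine ⟨AdjoinRoot (twoDivisionUCubic W), inferInstance, inferInstance, ?_, AdjoinRoot.root _, ?_⟩
  · rw [(AdjoinRoot.powerBasis h0).finrank, AdjoinRoot.powerBasis_dim, hdeg]
  · -- the `ℚ`-algebra structure found on the field `K` need not be `AdjoinRoot`'s syntactically: ring maps out of `ℚ` agree
    have hφ : algebraMap ℚ (AdjoinRoot (twoDivisionUCubic W)) = AdjoinRoot.of (twoDivisionUCubic W) :=
      Subsingleton.elim _ _
    rw [aeval_def, hφ]
    exact AdjoinRoot.eval₂_root _

omit [W.IsElliptic] in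
/-- **The `u`-cubic has a `2`-adic unit root at an ordinary `2`**: for `a₁` odd (integral model), some `u₀ ∈ ℤ₂` with
`‖u₀‖ = 1` satisfies `u₀³ + b₂u₀² + 8b₄u₀ + 16b₆ = 0` (Hensel at `u ≡ 1 (mod 2)`). [folklore] -/
theorem exists_padicInt_aeval_twoDivisionUCubic_eq_zero_of_odd_a₁ (ha₁ : Odd (integralModelInt W).a₁) :
    ∃ u : ℤ_[2], ‖u‖ = 1 ∧ aeval (u : ℚ_[2]) (twoDivisionUCubic W) = 0 := by
  haveI : Fact (Nat.Prime 2) := ⟨Nat.prime_two⟩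
  obtain ⟨hb₂, hb₄, hb₆⟩ := b₂_b₄_b₆_eq_intCast W
  obtain ⟨u, hu1, hu⟩ := exists_padicInt_root_of_odd (B₄ := (integralModelInt W).b₄)
    (B₆ := (integralModelInt W).b₆) (odd_b₂_integralModelInt_of_odd_a₁ W ha₁)
  refine ⟨u, hu1, ?_⟩
  simp only [twoDivisionUCubic, map_add, map_mul, map_pow, aeval_X, aeval_C, eq_ratCast, hb₂, hb₄, hb₆]
  push_cast
  linear_combination hu

/-- **Leaf currency**: for `W` good ordinary or multiplicative at `2` the `u`-cubic has a `2`-adic unit root. [folklore] -/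
theorem exists_padicInt_aeval_twoDivisionUCubic_eq_zero_of_goodOrd_or_mult (hW : GoodOrd W 2 ∨ Mult W 2) :
    ∃ u : ℤ_[2], ‖u‖ = 1 ∧ aeval (u : ℚ_[2]) (twoDivisionUCubic W) = 0 :=
  exists_padicInt_aeval_twoDivisionUCubic_eq_zero_of_odd_a₁ W (odd_a₁_integralModelInt_of_goodOrd_or_mult W hW)

end Summit.BirchSwinnertonDyer.BirchSwinnertonDyer.Theorems.TwoAdicTwistConverse

end
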